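/-
Cell b2b-lgcu-borel (gen 27).  VALUE = THEOREM (a structural law on every hypothetical witness of
the crux), NOT summit progress; the crux item `SubgroupIdentityDesigns`
(stmt-MatrixMultiplication-14079) stays open and untouched.
-/
import Mathlib
import Summits.MatrixMultiplication.MatrixMultiplication.Theorems.SubgroupIdentityDesigns.Negative.FreeModuleLaw
import Summits.MatrixMultiplication.MatrixMultiplication.Theorems.SubgroupIdentityDesigns.Negative.LevelOneInvariantDim
import Summits.MatrixMultiplication.MatrixMultiplication.Theorems.SubgroupIdentityDesigns.Negative.ScalarLaw

/-!
# The commuting-kernel law and the SCALAR BLOCK LAW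

Route `LevelGradedCohnUmans`, crux `SubgroupIdentityDesigns` (stmt-MatrixMultiplication-14079),
negative side; report `run/shared/lean/b2b/levelgraded-cu/ORACLE-g27.md` §G27-8.  VALUE = THEOREM
(an all-`(G, J)` law on hypothetical witnesses and its all-`(p, m)` level-one evaluation), NOT summit
progress; the crux item is untouched and remains open.

## The law (abstract form, any finite group)

Let `J ≤ ℂ^G` be bi-invariant, `(H₁, H₂, H₃)` subgroup-TPP and `f ∈ J` an identity test (`f 1 = 1`,
`f (a b c) = 0` for `a b c ≠ 1`).  The free-module law (`FreeModuleLaw`) periodises the NEUMANN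
probes over a subgroup `K ≤ H₃` and finds `(|H₁| + |H₂| − 1) · [H₃ : K]` independent functions in
the right `K`-invariants `J^K`.  THIS FILE periodises the TWO-SIDED TRANSLATES instead: if `K ≤ H₃`
COMMUTES WITH `H₂` (elementwise), the `|H₁| · |H₂|` functions

  `h ↦ Σ_{k ∈ K} f (a₀⁻¹ h b₀⁻¹ k)`   (`a₀ ∈ H₁`, `b₀ ∈ H₂`)

lie in `J^K` (commutation moves the period `k` past `b₀⁻¹`) and restrict to the point set `H₁ H₂`
as the delta functions `δ_{a₀ b₀}` (TPP read-out: `f (a₀⁻¹ a · b b₀⁻¹ · k) = [a = a₀, b = b₀, k = 1]`).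
Hence

  `|H₁| · |H₂| ≤ dim J^K`   (`card_mul_le_finrank_invRight_right`),

and for a CENTRAL `K` the same count in the other two positions: `K ≤ H₁ ⇒ |H₂| |H₃| ≤ dim J^K`,
`K ≤ H₂ ⇒ |H₁| |H₃| ≤ dim J^K` (`…_left`, `…_middle`).  Against the free-module law the probe
count `(|H₁| + |H₂| − 1) [H₃ : K]` is replaced by the PRODUCT `|H₁| |H₂|`, at the price of the
commutation hypothesis — which the scalar part of a member satisfies for free.

## The scalar block law (level one, all `p`, all `m ≥ 1`)

For a subgroup `K ≤ Hᵢ` of SCALAR matrices (`K ≤ range (scalarHom p m)`, so `|K| = s` divides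
`|Hᵢ ∩ Z|`), `K` is central and acts semiregularly on `𝔽_p^m ∖ 0`, so `LevelOneInvariantDim` gives
`|K| · dim (F_1)^K + |K| (b − 1) ≤ (p − 1) b²` (`b = #ℙ^{m-1}(𝔽_p)`).  Consequently every level-one
witness of the crux satisfies, for each member `Hᵢ` and each scalar subgroup `K ≤ Hᵢ` of order `s`,

  `s · (Π_{j ≠ i} |H_j|) + s (b − 1) ≤ (p − 1) b²`   (`scalar_block_law_right/left/middle`),

i.e. `Π_{j ≠ i} |H_j| ≤ ((p − 1) b² − s (b − 1)) / s ≈ dim F_1 / s`: a member meeting the centre in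
`s` elements cuts the budget of the other two by the factor `s` (representation-theoretically: the
design splits into its `s` central-character components, each confined to the level-one blocks with
that central character, and each component alone separates the `Π_{j ≠ i} |H_j|` points).  The
scalar law `ScalarLaw.scalar_law` (`|S₁||S₂||S₃| ∣ p − 1`) was the only use of the centre so far; at
`(m, p) = (3, 13)` the new law removes the threshold shape `(288, 624, 432)` of the level-one census
(`|H₃ ∩ Z| = 3`, `288 · 624 = 179 712 > 133 774`), ORACLE-g27 §G27-8.

Sorry-free; standard axioms.
-/

set_option linter.dupNamespace false

noncomputable section

open scoped BigOperators Classical Matrix LinearAlgebra.Projectivization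
open Module (finrank)

namespace Summit.MatrixMultiplication.MatrixMultiplication.Theorems.SubgroupIdentityDesigns.Negative
namespace ScalarBlockLaw

open Literature.Barriers.MatrixMultiplication (SubgroupTPP)
open FreeModuleLaw (invRight mem_invRight)

section Abstract

variable {G : Type} [Group G]

/-- `Σ_{k ∈ K} [c ∧ k = 1] = [c]`. -/
theorem sum_ite_and_eq_one [Fintype G] (K : Subgroup G) (c : Prop) [Decidable c] :
    (∑ k : K, if c ∧ k = 1 then (1 : ℂ) else 0) = if c then 1 else 0 := by
  by_cases hc : c
  · simp [hc, Finset.sum_ite_eq']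
  · simp [hc]

/-- **Product count from delta probes.**  If `W ≤ ℂ^G` contains, for every `(x₀, y₀) ∈ X × Y`, a
function whose values on the points `x y` are `[x = x₀ ∧ y = y₀]`, then `|X| · |Y| ≤ dim W`. -/
theorem card_mul_le_finrank_of_probes [Fintype G] {X Y : Subgroup G} (W : Submodule ℂ (G → ℂ))
    (P : X → Y → (G → ℂ)) (hP : ∀ x₀ y₀, P x₀ y₀ ∈ W)
    (hval : ∀ (x₀ : X) (y₀ : Y) (x : X) (y : Y),
      P x₀ y₀ ((x : G) * (y : G)) = if x = x₀ ∧ y = y₀ then 1 else 0) :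
    Nat.card X * Nat.card Y ≤ finrank ℂ W := by
  classical
  have h := LevelTwoBeatsCubes.Negative.card_add_card_le_finrank (A := X × Y) (S := PEmpty.{1})
    W (fun a => (a.1 : G) * (a.2 : G)) (fun s => s.elim) ?_ ?_
  · rw [Fintype.card_prod, Fintype.card_eq_zero (α := PEmpty.{1}), add_zero,
      ← Nat.card_eq_fintype_card, ← Nat.card_eq_fintype_card] at h
    exact h
  · rintro ⟨x₀, y₀⟩
    refine ⟨P x₀ y₀, hP x₀ y₀, ?_, ?_, fun s => s.elim⟩
    · show P x₀ y₀ ((x₀ : G) * (y₀ : G)) = 1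
      rw [hval]; simp
    · rintro ⟨x, y⟩ hne
      show P x₀ y₀ ((x : G) * (y : G)) = 0
      rw [hval, if_neg]
      rintro ⟨rfl, rfl⟩
      exact hne rfl
  · intro s; exact s.elim

variable [Fintype G]

/-- The `K`-periodised two-sided translate `h ↦ Σ_{k ∈ K} f (s h (t k))` of a function `f` of a
bi-invariant space `J` lies in `J^K` as soon as `K` commutes with `t`. -/
theorem probe_mem_invRight_of_comm (J : Submodule ℂ (G → ℂ))
    (hJ : ∀ f ∈ J, ∀ s t : G, (fun g => f (s * g * t)) ∈ J) (K : Subgroup G) {f : G → ℂ}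
    (hf : f ∈ J) (s t : G) (ht : ∀ k ∈ K, k * t = t * k) :
    (fun h => ∑ k : K, f (s * h * (t * k))) ∈ invRight K J := by
  refine ⟨?_, fun k₀ hk₀ h => ?_⟩
  · have hfun : (fun h => ∑ k : K, f (s * h * (t * k))) =
        ∑ k : K, fun h => f (s * h * (t * k)) := by
      ext h; simp [Finset.sum_apply]
    rw [hfun]
    exact Submodule.sum_mem _ fun k _ => hJ f hf _ _
  · show (∑ k : K, f (s * (h * k₀) * (t * k))) = ∑ k : K, f (s * h * (t * k))
    let e : K ≃ K := Equiv.mulLeft (⟨k₀, hk₀⟩ : K)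
    refine Fintype.sum_equiv e _ _ fun k => ?_
    have hk₀t : k₀ * t = t * k₀ := ht k₀ hk₀
    simp only [e, Equiv.coe_mulLeft, Subgroup.coe_mul]
    congr 1
    calc s * (h * k₀) * (t * k) = s * h * ((k₀ * t) * k) := by simp only [mul_assoc]
      _ = s * h * ((t * k₀) * k) := by rw [hk₀t]
      _ = s * h * (t * (k₀ * k)) := by simp only [mul_assoc]

/-- **THE COMMUTING-KERNEL LAW (right form).**  For a bi-invariant test space `J ≤ ℂ^G`, a
subgroup-TPP triple `(H₁, H₂, H₃)` carrying an identity test `f ∈ J`, and a subgroup `K ≤ H₃`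
commuting elementwise with `H₂`: `|H₁| · |H₂| ≤ dim J^K`. -/
theorem card_mul_le_finrank_invRight_right (J : Submodule ℂ (G → ℂ))
    (hJ : ∀ f ∈ J, ∀ s t : G, (fun g => f (s * g * t)) ∈ J)
    {H₁ H₂ H₃ : Subgroup G} (htpp : SubgroupTPP H₁ H₂ H₃)
    {f : G → ℂ} (hf : f ∈ J) (h1 : f 1 = 1)
    (h0 : ∀ a ∈ H₁, ∀ b ∈ H₂, ∀ c ∈ H₃, a * b * c ≠ 1 → f (a * b * c) = 0)
    {K : Subgroup G} (hK : K ≤ H₃) (hcomm : ∀ k ∈ K, ∀ b ∈ H₂, k * b = b * k) :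
    Nat.card H₁ * Nat.card H₂ ≤ finrank ℂ (invRight K J) := by
  refine card_mul_le_finrank_of_probes (invRight K J)
    (fun a₀ b₀ => fun h => ∑ k : K, f ((a₀ : G)⁻¹ * h * (((b₀ : G))⁻¹ * k)))
    (fun a₀ b₀ => probe_mem_invRight_of_comm J hJ K hf _ _
      fun k hk => hcomm k hk _ (H₂.inv_mem b₀.2)) fun a₀ b₀ a b => ?_
  show (∑ k : K, f ((a₀ : G)⁻¹ * ((a : G) * (b : G)) * (((b₀ : G))⁻¹ * k))) = _
  have hterm : ∀ k : K, f ((a₀ : G)⁻¹ * ((a : G) * (b : G)) * (((b₀ : G))⁻¹ * k)) =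
      if (a = a₀ ∧ b = b₀) ∧ k = 1 then 1 else 0 := by
    intro k
    have e : (a₀ : G)⁻¹ * ((a : G) * (b : G)) * (((b₀ : G))⁻¹ * k) =
        (a₀ : G)⁻¹ * (a : G) * ((b : G) * ((b₀ : G))⁻¹) * (k : G) := by simp only [mul_assoc]
    rw [e, idTest_apply_eq_ite htpp h1 h0 (H₁.mul_mem (H₁.inv_mem a₀.2) a.2)
      (H₂.mul_mem b.2 (H₂.inv_mem b₀.2)) (hK k.2)]
    by_cases h : (a = a₀ ∧ b = b₀) ∧ k = 1
    · obtain ⟨⟨rfl, rfl⟩, rfl⟩ := h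
      simp
    · rw [if_neg h, if_neg]
      rintro ⟨ha, hb, hk⟩
      exact h ⟨⟨(Subtype.ext (inv_mul_eq_one.1 ha)).symm, Subtype.ext (mul_inv_eq_one.1 hb)⟩,
        Subtype.ext hk⟩
  simp_rw [hterm]
  exact sum_ite_and_eq_one K _

/-- **THE COMMUTING-KERNEL LAW (left form, central kernel).**  For a CENTRAL subgroup `K ≤ H₁`:
`|H₂| · |H₃| ≤ dim J^K`. -/
theorem card_mul_le_finrank_invRight_left (J : Submodule ℂ (G → ℂ))
    (hJ : ∀ f ∈ J, ∀ s t : G, (fun g => f (s * g * t)) ∈ J)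
    {H₁ H₂ H₃ : Subgroup G} (htpp : SubgroupTPP H₁ H₂ H₃)
    {f : G → ℂ} (hf : f ∈ J) (h1 : f 1 = 1)
    (h0 : ∀ a ∈ H₁, ∀ b ∈ H₂, ∀ c ∈ H₃, a * b * c ≠ 1 → f (a * b * c) = 0)
    {K : Subgroup G} (hK : K ≤ H₁) (hcen : ∀ k ∈ K, ∀ g : G, k * g = g * k) :
    Nat.card H₂ * Nat.card H₃ ≤ finrank ℂ (invRight K J) := by
  refine card_mul_le_finrank_of_probes (invRight K J)
    (fun b₀ c₀ => fun h => ∑ k : K, f ((b₀ : G)⁻¹ * h * (((c₀ : G))⁻¹ * k)))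
    (fun b₀ c₀ => probe_mem_invRight_of_comm J hJ K hf _ _ fun k hk => hcen k hk _)
    fun b₀ c₀ b c => ?_
  show (∑ k : K, f ((b₀ : G)⁻¹ * ((b : G) * (c : G)) * (((c₀ : G))⁻¹ * k))) = _
  have hterm : ∀ k : K, f ((b₀ : G)⁻¹ * ((b : G) * (c : G)) * (((c₀ : G))⁻¹ * k)) =
      if (b = b₀ ∧ c = c₀) ∧ k = 1 then 1 else 0 := by
    intro k
    have hk := hcen k k.2
    have e : (b₀ : G)⁻¹ * ((b : G) * (c : G)) * (((c₀ : G))⁻¹ * k) =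
        (k : G) * ((b₀ : G)⁻¹ * (b : G)) * ((c : G) * ((c₀ : G))⁻¹) := by
      calc (b₀ : G)⁻¹ * ((b : G) * (c : G)) * (((c₀ : G))⁻¹ * k)
          = ((b₀ : G)⁻¹ * (b : G) * ((c : G) * ((c₀ : G))⁻¹)) * (k : G) := by
            simp only [mul_assoc]
        _ = (k : G) * ((b₀ : G)⁻¹ * (b : G) * ((c : G) * ((c₀ : G))⁻¹)) := (hk _).symm
        _ = (k : G) * ((b₀ : G)⁻¹ * (b : G)) * ((c : G) * ((c₀ : G))⁻¹) := by
            simp only [mul_assoc]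
    rw [e, idTest_apply_eq_ite htpp h1 h0 (hK k.2) (H₂.mul_mem (H₂.inv_mem b₀.2) b.2)
      (H₃.mul_mem c.2 (H₃.inv_mem c₀.2))]
    by_cases h : (b = b₀ ∧ c = c₀) ∧ k = 1
    · obtain ⟨⟨rfl, rfl⟩, rfl⟩ := h
      simp
    · rw [if_neg h, if_neg]
      rintro ⟨hk, hb, hc⟩
      exact h ⟨⟨(Subtype.ext (inv_mul_eq_one.1 hb)).symm, Subtype.ext (mul_inv_eq_one.1 hc)⟩,
        Subtype.ext hk⟩
  simp_rw [hterm]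
  exact sum_ite_and_eq_one K _

/-- **THE COMMUTING-KERNEL LAW (middle form, central kernel).**  For a CENTRAL subgroup `K ≤ H₂`:
`|H₁| · |H₃| ≤ dim J^K`. -/
theorem card_mul_le_finrank_invRight_middle (J : Submodule ℂ (G → ℂ))
    (hJ : ∀ f ∈ J, ∀ s t : G, (fun g => f (s * g * t)) ∈ J)
    {H₁ H₂ H₃ : Subgroup G} (htpp : SubgroupTPP H₁ H₂ H₃)
    {f : G → ℂ} (hf : f ∈ J) (h1 : f 1 = 1)
    (h0 : ∀ a ∈ H₁, ∀ b ∈ H₂, ∀ c ∈ H₃, a * b * c ≠ 1 → f (a * b * c) = 0)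
    {K : Subgroup G} (hK : K ≤ H₂) (hcen : ∀ k ∈ K, ∀ g : G, k * g = g * k) :
    Nat.card H₁ * Nat.card H₃ ≤ finrank ℂ (invRight K J) := by
  refine card_mul_le_finrank_of_probes (invRight K J)
    (fun a₀ c₀ => fun h => ∑ k : K, f ((a₀ : G)⁻¹ * h * (((c₀ : G))⁻¹ * k)))
    (fun a₀ c₀ => probe_mem_invRight_of_comm J hJ K hf _ _ fun k hk => hcen k hk _)
    fun a₀ c₀ a c => ?_
  show (∑ k : K, f ((a₀ : G)⁻¹ * ((a : G) * (c : G)) * (((c₀ : G))⁻¹ * k))) = _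
  have hterm : ∀ k : K, f ((a₀ : G)⁻¹ * ((a : G) * (c : G)) * (((c₀ : G))⁻¹ * k)) =
      if (a = a₀ ∧ c = c₀) ∧ k = 1 then 1 else 0 := by
    intro k
    have hk := hcen k k.2
    have e : (a₀ : G)⁻¹ * ((a : G) * (c : G)) * (((c₀ : G))⁻¹ * k) =
        (a₀ : G)⁻¹ * (a : G) * (k : G) * ((c : G) * ((c₀ : G))⁻¹) := by
      calc (a₀ : G)⁻¹ * ((a : G) * (c : G)) * (((c₀ : G))⁻¹ * k)
          = (a₀ : G)⁻¹ * (a : G) * (((c : G) * ((c₀ : G))⁻¹) * (k : G)) := by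
            simp only [mul_assoc]
        _ = (a₀ : G)⁻¹ * (a : G) * ((k : G) * ((c : G) * ((c₀ : G))⁻¹)) := by rw [← hk]
        _ = (a₀ : G)⁻¹ * (a : G) * (k : G) * ((c : G) * ((c₀ : G))⁻¹) := by
            simp only [mul_assoc]
    rw [e, idTest_apply_eq_ite htpp h1 h0 (H₁.mul_mem (H₁.inv_mem a₀.2) a.2) (hK k.2)
      (H₃.mul_mem c.2 (H₃.inv_mem c₀.2))]
    by_cases h : (a = a₀ ∧ c = c₀) ∧ k = 1
    · obtain ⟨⟨rfl, rfl⟩, rfl⟩ := h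
      simp
    · rw [if_neg h, if_neg]
      rintro ⟨ha, hk, hc⟩
      exact h ⟨⟨(Subtype.ext (inv_mul_eq_one.1 ha)).symm, Subtype.ext (mul_inv_eq_one.1 hc)⟩,
        Subtype.ext hk⟩
  simp_rw [hterm]
  exact sum_ite_and_eq_one K _

end Abstract

/-! ## Scalar subgroups of `GL_m(𝔽_p)`: central and semiregular -/

section Scalar

open Summit.MatrixMultiplication.MatrixMultiplication.Theorems.LieRankDesigns.Negative (GLm Mat)
open Summit.MatrixMultiplication.MatrixMultiplication.Theorems.LevelOneGL2Designs.Negative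
  (levelSubmodule levelSubmodule_bi_inv)
open PackingBridge (exists_test)

variable {p m : ℕ} [hp : Fact p.Prime]

/-- A subgroup of scalar matrices is central. -/
theorem central_of_le_range {K : Subgroup (GLm p m)} (hKZ : K ≤ (scalarHom p m).range) :
    ∀ k ∈ K, ∀ g : GLm p m, k * g = g * k := by
  intro k hk g
  obtain ⟨u, rfl⟩ := hKZ hk
  exact scalarHom_comm u g

/-- A subgroup of scalar matrices acts semiregularly on `𝔽_p^m ∖ 0`. -/
theorem semiregular_of_le_range {K : Subgroup (GLm p m)} (hKZ : K ≤ (scalarHom p m).range) :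
    ∀ k : K, ∀ v : Fin m → ZMod p, v ≠ 0 → k • v = v → k = 1 := by
  intro k v hv hkv
  obtain ⟨u, hu⟩ := hKZ k.2
  obtain ⟨i, hi⟩ : ∃ i, v i ≠ 0 := Function.ne_iff.mp hv
  have hs : (k • v : Fin m → ZMod p) = ((k : GLm p m) : Mat p m) *ᵥ v := rfl
  rw [hs, ← hu, coe_scalarHom] at hkv
  have hi' := congr_fun hkv i
  rw [Matrix.scalar_apply, Matrix.mulVec_diagonal] at hi'
  have hu1 : (u : ZMod p) = 1 := (mul_left_eq_self₀.1 hi').resolve_right hi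
  have hu1' : u = 1 := Units.ext hu1
  apply Subtype.ext
  rw [← hu, hu1', map_one]
  rfl

/-- **THE SCALAR BLOCK LAW (right form).**  For every level-one witness of `SubgroupIdentityDesigns`
in `GL_m(𝔽_p)` (`m ≥ 1`; subgroup TPP + the design clause verbatim at `k = 1`) and every subgroup
`K ≤ H₃` of scalar matrices: `|K| · |H₁| |H₂| + |K| (b − 1) ≤ (p − 1) b²`, `b = #ℙ^{m-1}(𝔽_p)`. -/
theorem scalar_block_law_right (hm : 1 ≤ m) {H₁ H₂ H₃ : Subgroup (GLm p m)}
    (htpp : SubgroupTPP H₁ H₂ H₃)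
    (hdes : ∃ c : Mat p m → ℂ, (∀ M, 1 < M.rank → c M = 0) ∧
      (∑ M, c M * ZMod.stdAddChar (Matrix.trace (M * ((1 : GLm p m) : Mat p m)))) = 1 ∧
      ∀ a ∈ H₁, ∀ b ∈ H₂, ∀ g ∈ H₃, a * b * g ≠ 1 →
        (∑ M, c M * ZMod.stdAddChar (Matrix.trace (M * ((a * b * g : GLm p m) : Mat p m)))) = 0)
    {K : Subgroup (GLm p m)} (hK : K ≤ H₃) (hKZ : K ≤ (scalarHom p m).range) :
    Nat.card K * (Nat.card H₁ * Nat.card H₂) +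
        Nat.card K * (Nat.card (ℙ (ZMod p) (Fin m → ZMod p)) - 1) ≤
      (p - 1) * Nat.card (ℙ (ZMod p) (Fin m → ZMod p)) ^ 2 := by
  obtain ⟨f, hf, h1, h0⟩ := exists_test hdes
  have hxy := card_mul_le_finrank_invRight_right (levelSubmodule p m 1) levelSubmodule_bi_inv htpp
    hf h1 h0 hK fun k hk b _ => central_of_le_range hKZ k hk b
  have hdim := LevelOneInvariantDim.card_mul_finrank_le_of_semiregular hm K
    (semiregular_of_le_range hKZ)
  exact le_trans (Nat.add_le_add_right (Nat.mul_le_mul_left _ hxy) _) hdim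

/-- **THE SCALAR BLOCK LAW (left form).**  `K ≤ H₁` scalar: `|K| · |H₂| |H₃| + |K| (b − 1) ≤ (p − 1) b²`. -/
theorem scalar_block_law_left (hm : 1 ≤ m) {H₁ H₂ H₃ : Subgroup (GLm p m)}
    (htpp : SubgroupTPP H₁ H₂ H₃)
    (hdes : ∃ c : Mat p m → ℂ, (∀ M, 1 < M.rank → c M = 0) ∧
      (∑ M, c M * ZMod.stdAddChar (Matrix.trace (M * ((1 : GLm p m) : Mat p m)))) = 1 ∧
      ∀ a ∈ H₁, ∀ b ∈ H₂, ∀ g ∈ H₃, a * b * g ≠ 1 →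
        (∑ M, c M * ZMod.stdAddChar (Matrix.trace (M * ((a * b * g : GLm p m) : Mat p m)))) = 0)
    {K : Subgroup (GLm p m)} (hK : K ≤ H₁) (hKZ : K ≤ (scalarHom p m).range) :
    Nat.card K * (Nat.card H₂ * Nat.card H₃) +
        Nat.card K * (Nat.card (ℙ (ZMod p) (Fin m → ZMod p)) - 1) ≤
      (p - 1) * Nat.card (ℙ (ZMod p) (Fin m → ZMod p)) ^ 2 := by
  obtain ⟨f, hf, h1, h0⟩ := exists_test hdes
  have hyz := card_mul_le_finrank_invRight_left (levelSubmodule p m 1) levelSubmodule_bi_inv htpp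
    hf h1 h0 hK (central_of_le_range hKZ)
  have hdim := LevelOneInvariantDim.card_mul_finrank_le_of_semiregular hm K
    (semiregular_of_le_range hKZ)
  exact le_trans (Nat.add_le_add_right (Nat.mul_le_mul_left _ hyz) _) hdim

/-- **THE SCALAR BLOCK LAW (middle form).**  `K ≤ H₂` scalar:
`|K| · |H₁| |H₃| + |K| (b − 1) ≤ (p − 1) b²`. -/
theorem scalar_block_law_middle (hm : 1 ≤ m) {H₁ H₂ H₃ : Subgroup (GLm p m)}
    (htpp : SubgroupTPP H₁ H₂ H₃)
    (hdes : ∃ c : Mat p m → ℂ, (∀ M, 1 < M.rank → c M = 0) ∧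
      (∑ M, c M * ZMod.stdAddChar (Matrix.trace (M * ((1 : GLm p m) : Mat p m)))) = 1 ∧
      ∀ a ∈ H₁, ∀ b ∈ H₂, ∀ g ∈ H₃, a * b * g ≠ 1 →
        (∑ M, c M * ZMod.stdAddChar (Matrix.trace (M * ((a * b * g : GLm p m) : Mat p m)))) = 0)
    {K : Subgroup (GLm p m)} (hK : K ≤ H₂) (hKZ : K ≤ (scalarHom p m).range) :
    Nat.card K * (Nat.card H₁ * Nat.card H₃) +
        Nat.card K * (Nat.card (ℙ (ZMod p) (Fin m → ZMod p)) - 1) ≤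
      (p - 1) * Nat.card (ℙ (ZMod p) (Fin m → ZMod p)) ^ 2 := by
  obtain ⟨f, hf, h1, h0⟩ := exists_test hdes
  have hxz := card_mul_le_finrank_invRight_middle (levelSubmodule p m 1) levelSubmodule_bi_inv htpp
    hf h1 h0 hK (central_of_le_range hKZ)
  have hdim := LevelOneInvariantDim.card_mul_finrank_le_of_semiregular hm K
    (semiregular_of_le_range hKZ)
  exact le_trans (Nat.add_le_add_right (Nat.mul_le_mul_left _ hxz) _) hdim

omit hp in
/-- The scalar part `Hᵢ ∩ Z` of a member, as a subgroup of `GL_m(𝔽_p)`: the image of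
`ScalarLaw`'s `Sᵢ = Hᵢ.comap scalarHom`.  It lies in `Hᵢ` and in the range of `scalarHom`, and has
the cardinality of `Sᵢ` (`m ≥ 1`), so the three laws apply to it with `|K| = |Hᵢ ∩ Z|`. -/
theorem scalarPart_le (H : Subgroup (GLm p m)) :
    (H.comap (scalarHom p m)).map (scalarHom p m) ≤ H := Subgroup.map_comap_le _ _

omit hp in
/-- The scalar part of `H` consists of scalar matrices. -/
theorem scalarPart_le_range (H : Subgroup (GLm p m)) :
    (H.comap (scalarHom p m)).map (scalarHom p m) ≤ (scalarHom p m).range :=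
  Subgroup.map_le_range _ _

/-- The scalar part of `H` has the cardinality of `H.comap scalarHom` (`m ≥ 1`). -/
theorem card_scalarPart [NeZero m] (H : Subgroup (GLm p m)) :
    Nat.card ((H.comap (scalarHom p m)).map (scalarHom p m)) = Nat.card (H.comap (scalarHom p m)) :=
  Subgroup.card_map_of_injective scalarHom_injective

/-- **Scalar block law, `Hᵢ ∩ Z` form (right).**  With `s = |H₃ ∩ Z|`:
`s · |H₁| |H₂| + s (b − 1) ≤ (p − 1) b²`. -/
theorem scalar_block_law_right' (hm : 1 ≤ m) {H₁ H₂ H₃ : Subgroup (GLm p m)}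
    (htpp : SubgroupTPP H₁ H₂ H₃)
    (hdes : ∃ c : Mat p m → ℂ, (∀ M, 1 < M.rank → c M = 0) ∧
      (∑ M, c M * ZMod.stdAddChar (Matrix.trace (M * ((1 : GLm p m) : Mat p m)))) = 1 ∧
      ∀ a ∈ H₁, ∀ b ∈ H₂, ∀ g ∈ H₃, a * b * g ≠ 1 →
        (∑ M, c M * ZMod.stdAddChar (Matrix.trace (M * ((a * b * g : GLm p m) : Mat p m)))) = 0) :
    Nat.card (H₃.comap (scalarHom p m)) * (Nat.card H₁ * Nat.card H₂) +
        Nat.card (H₃.comap (scalarHom p m)) * (Nat.card (ℙ (ZMod p) (Fin m → ZMod p)) - 1) ≤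
      (p - 1) * Nat.card (ℙ (ZMod p) (Fin m → ZMod p)) ^ 2 := by
  haveI : NeZero m := ⟨by omega⟩
  rw [← card_scalarPart H₃]
  exact scalar_block_law_right hm htpp hdes (scalarPart_le H₃) (scalarPart_le_range H₃)

end Scalar

end ScalarBlockLaw
end Summit.MatrixMultiplication.MatrixMultiplication.Theorems.SubgroupIdentityDesigns.Negative

end
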